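import Summits.QuantumFields.BalabanUV.T4Continuum.Spine.NE5.EnvelopeOnRecord
import Literature.MathematicalPhysics.QuantumFieldTheory.Balaban1983to89.Beta.RemainderStepAdapterHolo

/-!
# Spine/NE5/StepObjectFromActivities — the JUNCTION between row NE5's W2 datum and row (D4)'s NODE-O inputs:
# ONE H-layer datum (NE5's `act` + `hH`) and a holomorphic background seam give row D4's `StepObjectD4` with
# `Lemma3OnH` and the activity-holomorphy leaf, BY NAME (cell `pub-balaban-gaps`, YM blitz Y1, track G2, seat `ne5` gen 3)

Triage sheet `HOME/ne/NE5.md` §7 (G-c) ∕ §9 (n1) and row (D4)'s builder list `pub-balaban/b2b-balaban-beta-an4/D4-CRUX-SOCKETS.md` §9 (K3)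
both say, in prose, that the H-LAYER DATUM of [Balaban1988RG2Cluster] §2 — the resummed activities `H(Z)` ((2.9)∕(2.37)) as functions of
their inputs, holomorphic with the Lemma-3 majorant (2.38) — is ONE object serving two rows: NE5 reads it in the (operator, history)-DATA
direction (`Spine/NE5/EnvelopeOnRecord.outputEnvelope_of_activities_record`: hypothesis `hH`), row D4 reads it in the BACKGROUND-
CONFIGURATION direction along the (4.4)-seam of [Balaban1987RG1] p. 281 (`Beta.RemainderStepAdapterHolo.StepObjectD4` + `Lemma3OnH` +
`hH` of `toPolLeavesTFac190H_ofActivities`).  This file makes the sentence a kernel fact, per torus size: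

* §1 `stepObjectOfActivities Φ dat act V` — the `StepObjectD4 d N` whose configurations `Φ` are mapped to data points by
  `dat : Φ → Op × Hist` (the (T3)-map «configuration ↦ (operators, potentials) of the step», [II] (1.5) p. 3 ∕ [B9] (3.35)–(3.38): a
  PARAMETER here), whose activities are `H Z φ := act (dat φ) Z` and whose analyticity domains are `sp2 X := dat ⁻¹' V` for the data
  region `V` on which the H-layer datum holds (restriction property trivial).  Then: the (2.38)-majorant on `V` IS `Lemma3OnH`
  (`lemma3OnH_of_activities`, letters `A = C₃ε₁`, `R = (1 − 8δ)ℓκ`; monotone version `lemma3OnH_of_activities_mono`); per-polymer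
  holomorphy of `act` on `V` composed with a seam `s : Wn → Φ` whose data image `dat ∘ s` is holomorphic on the α₂-ball and stays
  in `V` IS row D4's activity-holomorphy leaf (`differentiableOn_H_of_activities`, Mathlib `DifferentiableOn.comp`) and its `hemb`
  (`mem_sp2_of_mapsTo`); and the E-layer leaf follows by the row-D4 owner's `StepObjectD4.differentiableOn_E_of_activities`
  (`differentiableOn_E_of_activities_seam`).
* §2 ON THE CARRIERS OF RECORD `B13Carriers.TwoRuns.carriers R`: from EXACTLY the hypothesis `hH` of
  `EnvelopeOnRecord.outputEnvelope_of_activities_record` at ONE admissible base point `p ∈ M.Base j g U` (the ∃-form: an open `V ⊇ box j p`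
  carrying holomorphy and the majorant), the object `stepObjectOfActivitiesAt M j p Φ dat (act j)` with `sp2 := dat ⁻¹' (M.box j p)` (the
  admissible two-margin box (2.16)–(2.18) itself) has `Lemma3OnH c ℓ` (`lemma3OnH_at_of_hH`) and the activity-holomorphy leaf along
  every seam whose data image is holomorphic on the α₂-ball and stays inside the box (`differentiableOn_H_at_of_hH`) — the located
  COMPATIBILITY condition between [I]'s (4.4)-radius α₂ and [II]'s margins, displayed as `MapsTo (dat ∘ s) (ball 0 α₂) (M.box j p)`
  and discharged in margin letters by `mapsTo_box_of_margins` (operator component moves ≤ `rOp j`, history component ≤ `rHist j`) ∕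
  `mapsTo_box_of_lipschitzOnWith` (a `K`-Lipschitz data image through `p` with `K·α₂ ≤ rOp j`, `K·α₂ ≤ rHist j`).
  And the E-LAYER IDENTITY `E_at_eq_out`: the object's `E X φ` ((2.13) as D4 defines it) IS NE5's `M.Out j` at the data point `dat φ`
  under NE5's representation hypothesis `hrep` — ONE E^{(k+1)} for both rows.
* §3 the torus-FAMILY corollary `polLeavesTFac190HOfActivities` (a `def`: the socket is a structure): per torus `n` of an exhausting sequence an H-layer datum
  `(act n, V n)` + seams ⟹ row D4's holomorphic-currency socket `Beta.RemainderLocalityHolo.PolLeavesTFac190H` by the owner's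
  `toPolLeavesTFac190H_ofActivities`, every other argument (the (190)-side `Data190`, the (1.7)-factorization ∕ test-vector data) passed
  through untouched — so `Gaps.D4ScaleSlice.abs_beta1_le_of_leaves_at` applies.

WHAT THIS SHOWS, EXACTLY.  Direction NE5 ⟹ D4 only: the builder who hands row NE5 its W2 datum (activities holomorphic in the DATA with a
data-uniform (2.38)-majorant near the admissible boxes) and the (T3)-seam (data holomorphic in the complex background configuration on the
(4.4)-ball, image inside the box) has ALSO produced row D4's K3 inputs; the converse is false in general (D4's datum knows holomorphy along
background seams only).  HONEST FRAMING.  Bookkeeping by composition over two LANDED interfaces (p341430, p340881); `act`, `dat`, the seams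
and every bound are HYPOTHESES; nothing of Bałaban's is constructed or asserted; NE5 NOT PRINTED ∕ NOT PROVED, (D4) NOT discharged, NODE O
instance 0∕1; 0∕12 NE5 leaves on Bałaban's objects.  Rung (B)+1 on a FIXED finite T⁴ — NOT continuum by itself, NOT infinite volume, NOT
mass gap, NOT Clay.  Spine PROVED 0∕9.  HONEST DEPENDENCY: continuum YM on T⁴ ⇐ BetaPertH ∧ nine spine estimates; BetaPertH ⇐ (D1) ∧ (D4)
∧ CAP+tail.  0 sorry, 0 new `Prop`; the three `def`s are DATA (two instances of the row-D4 owner's structure `StepObjectD4`, one of its socket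
`PolLeavesTFac190H`), docstring'd.
-/

noncomputable section

open Set Metric Filter Topology

namespace Summit.QuantumFields.BalabanUV.T4Continuum.Spine.NE5

open Literature.MathematicalPhysics.QuantumFieldTheory.Balaban1983to89
open Literature.MathematicalPhysics.QuantumFieldTheory.Balaban1983to89.T4InputCauchyRateData
open Literature.MathematicalPhysics.QuantumFieldTheory.Balaban1983to89.B13Resummation (locE)
open Literature.MathematicalPhysics.QuantumFieldTheory.Balaban1983to89.TreeLengthTorus (TPt TDom tsys torusTreeLen proj)
open Literature.MathematicalPhysics.QuantumFieldTheory.Balaban1983to89.TreeLengthTorusGeometry (TTouch)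
open Literature.MathematicalPhysics.QuantumFieldTheory.Balaban1983to89.B13ScaleTransfer (Pt)
open Literature.MathematicalPhysics.QuantumFieldTheory.Balaban1983to89.B12Decay510 (mixedDeriv)
open Literature.MathematicalPhysics.QuantumFieldTheory.Balaban1983to89.Beta.RemainderStepAdapterHolo
  (StepObjectD4 toPolLeavesTFac190H_ofActivities)
open Literature.MathematicalPhysics.QuantumFieldTheory.Balaban1983to89.Beta.RemainderLimitTorus (LDom tproj)
open Literature.MathematicalPhysics.QuantumFieldTheory.Balaban1983to89.Beta.RemainderDecay190 (Consts190 Data190)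
open Literature.MathematicalPhysics.QuantumFieldTheory.Balaban1983to89.Beta.RemainderLocalityHolo (PolLeavesTFac190H)
open Literature.MathematicalPhysics.QuantumFieldTheory.Balaban1983to89.Beta.RemainderChainLattice (CondsL)
open Summit.QuantumFields.BalabanUV.T4Continuum.B13Carriers (TwoRuns)

/-! ## §1 One torus: the D4 step object whose configurations are mapped to NE5 data points -/

section OneTorus

variable {d N : ℕ} [NeZero N]
variable {Op Hist : Type*}

/-- **THE D4 STEP OBJECT OF AN H-LAYER DATUM.**  Configurations `Φ` (row D4's complexified background configurations — a
parameter), the data map `dat : Φ → Op × Hist` («configuration ↦ (operators, potentials ∕ history) of the step», the (T3)-map of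
[II] (1.5) p. 3; a parameter), NE5's data-dependent activities `act : Op × Hist → 𝐃 → ℂ` on the torus with `N` cubes per direction,
and the data region `V` where NE5's H-layer datum holds.  Activities of the object: `H Z φ := act (dat φ) Z`; analyticity domains:
`sp2 X := dat ⁻¹' V` for every `X` (restriction property `hsp` trivial).  DATA; no estimate inside.
[cite: Balaban1988RG2Cluster, (2.9) p.14 and p.15] -/
def stepObjectOfActivities (Φ : Type) (dat : Φ → Op × Hist) (act : Op × Hist → TDom d N → ℂ) (V : Set (Op × Hist)) :
    StepObjectD4 d N where
  Φ := Φ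
  sp2 := fun _ => dat ⁻¹' V
  H := fun Z φ => act (dat φ) Z
  hsp := fun _ _ _ _ h => h

variable {Φ : Type} {dat : Φ → Op × Hist} {act : Op × Hist → TDom d N → ℂ} {V : Set (Op × Hist)}

/-- The object's activities are NE5's activities at the data of the configuration. [folklore] -/
@[simp] theorem stepObjectOfActivities_H (Z : TDom d N) (φ : Φ) :
    (stepObjectOfActivities Φ dat act V).H Z φ = act (dat φ) Z := rfl

/-- The object's analyticity domain at every `X` is the preimage of the data region. [folklore] -/
@[simp] theorem stepObjectOfActivities_sp2 (X : TDom d N) :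
    (stepObjectOfActivities Φ dat act V).sp2 X = dat ⁻¹' V := rfl

/-- Membership in the object's analyticity domain = the data point lies in `V`. [folklore] -/
theorem mem_sp2_iff (X : TDom d N) (φ : Φ) : φ ∈ (stepObjectOfActivities Φ dat act V).sp2 X ↔ dat φ ∈ V := Iff.rfl

/-- **(2.38) ON THE DATA REGION IS ROW D4's `Lemma3OnH`.**  If NE5's majorant holds on `V` with the Lemma-3 letters — constant
`C₃ε₁` (`c.C3act * c.ε₁`) and rate `(1 − 8δ)ℓκ` against the torus tree length — then the object satisfies
`StepObjectD4.Lemma3OnH c ℓ` (`(tsys d N).dj = torusTreeLen` by definition). [cite: Balaban1988RG2Cluster, (2.38) p.20] -/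
theorem lemma3OnH_of_activities {c : B13.Consts} {ℓ : ℝ}
    (hmaj : ∀ z ∈ V, ∀ Z : TDom d N,
      ‖act z Z‖ ≤ c.C3act * c.ε₁ * Real.exp (-((1 - 8 * c.δ) * ℓ * c.κ * torusTreeLen Z.1))) :
    (stepObjectOfActivities Φ dat act V).Lemma3OnH c ℓ :=
  fun Z φ hφ => hmaj (dat φ) hφ Z

/-- **Monotone letters.**  NE5 states its majorant as `A·exp(−R·d(Z))`; any `0 ≤ A ≤ C₃ε₁` and `R ≥ (1 − 8δ)ℓκ` give `Lemma3OnH c ℓ`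
(tree length is non-negative). [cite: Balaban1988RG2Cluster, (2.38) p.20] -/
theorem lemma3OnH_of_activities_mono {c : B13.Consts} {ℓ A R : ℝ}
    (hmaj : ∀ z ∈ V, ∀ Z : TDom d N, ‖act z Z‖ ≤ A * Real.exp (-(R * torusTreeLen Z.1)))
    (hA0 : 0 ≤ A) (hA : A ≤ c.C3act * c.ε₁) (hR : (1 - 8 * c.δ) * ℓ * c.κ ≤ R) :
    (stepObjectOfActivities Φ dat act V).Lemma3OnH c ℓ := by
  refine lemma3OnH_of_activities fun z hz Z => (hmaj z hz Z).trans ?_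
  have ht : 0 ≤ torusTreeLen Z.1 := TreeLengthTorus.torusTreeLen_nonneg Z.1
  have hexp : Real.exp (-(R * torusTreeLen Z.1)) ≤
      Real.exp (-((1 - 8 * c.δ) * ℓ * c.κ * torusTreeLen Z.1)) :=
    Real.exp_le_exp.2 (by nlinarith)
  calc A * Real.exp (-(R * torusTreeLen Z.1))
      ≤ A * Real.exp (-((1 - 8 * c.δ) * ℓ * c.κ * torusTreeLen Z.1)) := mul_le_mul_of_nonneg_left hexp hA0
    _ ≤ c.C3act * c.ε₁ * Real.exp (-((1 - 8 * c.δ) * ℓ * c.κ * torusTreeLen Z.1)) :=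
        mul_le_mul_of_nonneg_right hA (Real.exp_pos _).le

variable {Wn : Type*} [NormedAddCommGroup Wn]

/-- **A seam whose data image stays in `V` lands in the object's analyticity domains** (row D4's `hemb`).
[cite: Balaban1987RG1, (4.4) p.281] -/
theorem mem_sp2_of_mapsTo {s : Wn → Φ} {α₂ : ℝ} (hmaps : MapsTo (fun v => dat (s v)) (ball 0 α₂) V) (X : TDom d N) :
    ∀ v ∈ ball (0 : Wn) α₂, s v ∈ (stepObjectOfActivities Φ dat act V).sp2 X :=
  fun _ hv => hmaps hv

variable [NormedAddCommGroup Op] [NormedSpace ℂ Op] [NormedAddCommGroup Hist] [NormedSpace ℂ Hist] [NormedSpace ℂ Wn]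

/-- **PER-POLYMER HOLOMORPHY IN THE DATA ∘ A HOLOMORPHIC SEAM = ROW D4's ACTIVITY-HOLOMORPHY LEAF.**  If every activity
`z ↦ act z Z` is ℂ-differentiable on `V` (NE5's H-layer datum) and the seam's data image `v ↦ dat (s v)` is ℂ-differentiable on the
α₂-ball and stays in `V` (the (T3)-seam), then `v ↦ H(Z, s v)` is ℂ-differentiable on the α₂-ball for every polymer `Z` — the `hH`
of `toPolLeavesTFac190H_ofActivities` (there asked only for `Z ⊂ X`). Mathlib `DifferentiableOn.comp`.
[cite: Balaban1988RG2Cluster, p.15; Balaban1987RG1, (4.4) p.281] -/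
theorem differentiableOn_H_of_activities (hhol : ∀ Z : TDom d N, DifferentiableOn ℂ (fun z : Op × Hist => act z Z) V)
    {s : Wn → Φ} {α₂ : ℝ} (hs : DifferentiableOn ℂ (fun v => dat (s v)) (ball 0 α₂))
    (hmaps : MapsTo (fun v => dat (s v)) (ball 0 α₂) V) (Z : TDom d N) :
    DifferentiableOn ℂ (fun v => (stepObjectOfActivities Φ dat act V).H Z (s v)) (ball 0 α₂) :=
  (hhol Z).comp hs hmaps

/-- **The E-layer leaf along the seam** (row D4's former `hdiff`), by the row-D4 owner's seam lemma
`StepObjectD4.differentiableOn_E_of_activities`: under `CondsL d c ℓ` and `0 ≤ C₃ε₁`, (2.38) on `V` and per-polymer holomorphy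
on `V` composed with the seam give ℂ-differentiability of `v ↦ E(X, s v)` ((2.13) AS DEFINED) on the α₂-ball.
[cite: Balaban1988RG2Cluster, (2.13) p.14, p.15 and (2.38) p.20; Balaban1987RG1, (4.4) p.281] -/
theorem differentiableOn_E_of_activities_seam {c : B13.Consts} {ℓ : ℝ}
    (hmaj : ∀ z ∈ V, ∀ Z : TDom d N,
      ‖act z Z‖ ≤ c.C3act * c.ε₁ * Real.exp (-((1 - 8 * c.δ) * ℓ * c.κ * torusTreeLen Z.1)))
    (hC : CondsL d c ℓ) (hA : 0 ≤ c.C3act * c.ε₁)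
    (hhol : ∀ Z : TDom d N, DifferentiableOn ℂ (fun z : Op × Hist => act z Z) V)
    {s : Wn → Φ} {α₂ : ℝ} (hs : DifferentiableOn ℂ (fun v => dat (s v)) (ball 0 α₂))
    (hmaps : MapsTo (fun v => dat (s v)) (ball 0 α₂) V) (X : TDom d N) :
    DifferentiableOn ℂ (fun v => (stepObjectOfActivities Φ dat act V).E X (s v)) (ball 0 α₂) :=
  (stepObjectOfActivities Φ dat act V).differentiableOn_E_of_activities (lemma3OnH_of_activities hmaj) hC hA X s
    (mem_sp2_of_mapsTo hmaps X) fun Z _ => differentiableOn_H_of_activities hhol hs hmaps Z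

end OneTorus

/-! ## §2 On the carriers of record: from EXACTLY NE5's `hH` at one admissible base point -/

section Record

variable {G : Type} [GaugeGroup G] (R : TwoRuns G)
variable {Op Hist : Type*} [NormedAddCommGroup Op] [NormedSpace ℂ Op] [NormedAddCommGroup Hist] [NormedSpace ℂ Hist]
  (M : StepModel R.carriers Op Hist)

/-- **THE OBJECT AT AN ADMISSIBLE BASE POINT.**  At scale `j` and base point `p` (a point of the one-run class `M.Base j g U`), the D4
step object on the scale-`j` torus `TDom 4 (R.cubesPerDir j)` with NE5's scale-`j` activities, whose analyticity domains are the
configurations whose data lie in the admissible two-margin box `M.box j p` ((2.16)–(2.17) operator margin `rOp j`, (2.18) potential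
budget `rHist j`).  DATA. [cite: Balaban1988RG2Cluster, (2.16)-(2.18) p.16] -/
def stepObjectOfActivitiesAt (j : ℕ) (p : Op × Hist) (Φ : Type) (dat : Φ → Op × Hist)
    (act : Op × Hist → TDom 4 (R.cubesPerDir j) → ℂ) : StepObjectD4 4 (R.cubesPerDir j) :=
  stepObjectOfActivities Φ dat act (M.box j p)

variable {act : (j : ℕ) → Op × Hist → TDom 4 (R.cubesPerDir j) → ℂ} {W : Set (ℕ → ℝ)} {A Rd : ℝ}

/-- **`Lemma3OnH` FROM NE5's `hH`.**  NE5's H-layer datum (verbatim the hypothesis `hH` of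
`EnvelopeOnRecord.outputEnvelope_of_activities_record`) at an admissible base point `p ∈ M.Base j g U`, with letters
`0 ≤ A ≤ C₃ε₁`, `(1 − 8δ)ℓκ ≤ R`, gives row D4's displayed (2.38) for the object at `p`.
[cite: Balaban1988RG2Cluster, (2.38) p.20] -/
theorem lemma3OnH_at_of_hH
    (hH : ∀ j, ∀ g ∈ W, ∀ (U : R.carriers.BgB) (p : Op × Hist), p ∈ M.Base j g U →
      ∃ V : Set (Op × Hist), IsOpen V ∧ M.box j p ⊆ V ∧
        (∀ Z : TDom 4 (R.cubesPerDir j), DifferentiableOn ℂ (fun z : Op × Hist => act j z Z) V) ∧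
        (∀ z ∈ V, ∀ Z : TDom 4 (R.cubesPerDir j), ‖act j z Z‖ ≤ A * Real.exp (-(Rd * torusTreeLen Z.1))))
    {c : B13.Consts} {ℓ : ℝ} (hA0 : 0 ≤ A) (hA : A ≤ c.C3act * c.ε₁) (hR : (1 - 8 * c.δ) * ℓ * c.κ ≤ Rd)
    {j : ℕ} {g : ℕ → ℝ} (hg : g ∈ W) {U : R.carriers.BgB} {p : Op × Hist} (hp : p ∈ M.Base j g U)
    (Φ : Type) (dat : Φ → Op × Hist) :
    (stepObjectOfActivitiesAt R M j p Φ dat (act j)).Lemma3OnH c ℓ := by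
  obtain ⟨V, -, hbox, -, hmaj⟩ := hH j g hg U p hp
  exact lemma3OnH_of_activities_mono (fun z hz Z => hmaj z (hbox hz) Z) hA0 hA hR

variable {Wn : Type*} [NormedAddCommGroup Wn]

/-- The seam lands in the object's analyticity domains (row D4's `hemb`) when its data image stays in the box. [folklore] -/
theorem mem_sp2_at_of_mapsTo {j : ℕ} {p : Op × Hist} (Φ : Type) (dat : Φ → Op × Hist) {s : Wn → Φ} {α₂ : ℝ}
    (hmaps : MapsTo (fun v => dat (s v)) (ball 0 α₂) (M.box j p)) (X : TDom 4 (R.cubesPerDir j)) :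
    ∀ v ∈ ball (0 : Wn) α₂, s v ∈ (stepObjectOfActivitiesAt R M j p Φ dat (act j)).sp2 X :=
  fun _ hv => hmaps hv

/-- **THE SEAM CONDITION IN MARGIN LETTERS.**  The data image of the seam stays in the admissible box of `p` as soon as, along the
α₂-ball, the operator component moves by at most the operator margin `rOp j` ((2.16)–(2.17)) and the history component by at most the
potential budget slack `rHist j` ((2.18)) — the two located inequalities a NODE-O builder owes for the junction.
[cite: Balaban1988RG2Cluster, (2.16)-(2.18) p.16; Balaban1987RG1, (4.4) p.281] -/
theorem mapsTo_box_of_margins {j : ℕ} {p : Op × Hist} {Φ : Type} {dat : Φ → Op × Hist} {s : Wn → Φ} {α₂ : ℝ}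
    (hOp : ∀ v ∈ ball (0 : Wn) α₂, ‖(dat (s v)).1 - p.1‖ ≤ M.rOp j)
    (hHist : ∀ v ∈ ball (0 : Wn) α₂, ‖(dat (s v)).2 - p.2‖ ≤ M.rHist j) :
    MapsTo (fun v => dat (s v)) (ball 0 α₂) (M.box j p) := fun v hv =>
  ⟨mem_closedBall_iff_norm.2 (hOp v hv), mem_closedBall_iff_norm.2 (hHist v hv)⟩

/-- **THE SEAM CONDITION FROM A LIPSCHITZ (T3)-MAP.**  If the seam's data image is `K`-Lipschitz on the α₂-ball, passes through `p`
at the centre, and `K·α₂` is below both margins, the data image stays in the box: the printed-kind smallness «α₂ small against the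
(2.16)–(2.18) margins». [cite: Balaban1988RG2Cluster, (2.16)-(2.18) p.16; Balaban1987RG1, (4.4) p.281] -/
theorem mapsTo_box_of_lipschitzOnWith {j : ℕ} {p : Op × Hist} {Φ : Type} {dat : Φ → Op × Hist} {s : Wn → Φ} {α₂ : ℝ}
    {K : NNReal} (hK : LipschitzOnWith K (fun v => dat (s v)) (ball 0 α₂)) (h0 : dat (s 0) = p) (hα₂ : 0 < α₂)
    (hOp : (K : ℝ) * α₂ ≤ M.rOp j) (hHist : (K : ℝ) * α₂ ≤ M.rHist j) :
    MapsTo (fun v => dat (s v)) (ball 0 α₂) (M.box j p) := by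
  have hmain : ∀ v ∈ ball (0 : Wn) α₂, ‖dat (s v) - p‖ ≤ (K : ℝ) * α₂ := fun v hv => by
    have h0mem : (0 : Wn) ∈ ball (0 : Wn) α₂ := mem_ball_self hα₂
    have hd := hK.dist_le_mul v hv 0 h0mem
    rw [h0, dist_eq_norm, dist_zero_right] at hd
    exact hd.trans (mul_le_mul_of_nonneg_left (le_of_lt (mem_ball_zero_iff.1 hv)) K.2)
  refine mapsTo_box_of_margins R M (fun v hv => ?_) (fun v hv => ?_)
  · exact ((norm_fst_le (dat (s v) - p)).trans (hmain v hv)).trans hOp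
  · exact ((norm_snd_le (dat (s v) - p)).trans (hmain v hv)).trans hHist

variable [NormedSpace ℂ Wn]

/-- **THE ACTIVITY-HOLOMORPHY LEAF FROM NE5's `hH`** along any seam whose data image is ℂ-differentiable on the α₂-ball and stays in
the admissible box of `p` (the COMPATIBILITY of [I]'s (4.4)-radius with [II]'s margins, displayed).
[cite: Balaban1988RG2Cluster, p.15 and (2.16)-(2.18) p.16; Balaban1987RG1, (4.4) p.281] -/
theorem differentiableOn_H_at_of_hH
    (hH : ∀ j, ∀ g ∈ W, ∀ (U : R.carriers.BgB) (p : Op × Hist), p ∈ M.Base j g U →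
      ∃ V : Set (Op × Hist), IsOpen V ∧ M.box j p ⊆ V ∧
        (∀ Z : TDom 4 (R.cubesPerDir j), DifferentiableOn ℂ (fun z : Op × Hist => act j z Z) V) ∧
        (∀ z ∈ V, ∀ Z : TDom 4 (R.cubesPerDir j), ‖act j z Z‖ ≤ A * Real.exp (-(Rd * torusTreeLen Z.1))))
    {j : ℕ} {g : ℕ → ℝ} (hg : g ∈ W) {U : R.carriers.BgB} {p : Op × Hist} (hp : p ∈ M.Base j g U)
    (Φ : Type) (dat : Φ → Op × Hist) {s : Wn → Φ} {α₂ : ℝ}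
    (hs : DifferentiableOn ℂ (fun v => dat (s v)) (ball 0 α₂)) (hmaps : MapsTo (fun v => dat (s v)) (ball 0 α₂) (M.box j p))
    (Z : TDom 4 (R.cubesPerDir j)) :
    DifferentiableOn ℂ (fun v => (stepObjectOfActivitiesAt R M j p Φ dat (act j)).H Z (s v)) (ball 0 α₂) := by
  obtain ⟨V, -, hbox, hhol, -⟩ := hH j g hg U p hp
  exact ((hhol Z).mono hbox).comp hs hmaps

variable [∀ j, DecidableEq (TDom 4 (R.cubesPerDir j))] [∀ j, DecidableRel (TTouch (d := 4) (N := R.cubesPerDir j))]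

/-- **ONE E^{(k+1)} FOR BOTH ROWS.**  Under NE5's representation hypothesis `hrep` («the output at `⟨j, X⟩` IS (2.13) of the scale-`j`
activities», verbatim from `EnvelopeOnRecord.outputEnvelope_of_activities_record`), the object's `E X φ` — (2.13) as row D4 DEFINES it
(`StepObjectD4.E`) — equals NE5's step output `M.Out j` at the data point `dat φ`.  (The two `locE` terms carry possibly different
decidability instances; these are subsingletons.) [cite: Balaban1988RG2Cluster, (2.13) p.14] -/
theorem E_at_eq_out
    (hrep : ∀ (X : R.carriers.Dom) (z : Op × Hist),
      M.Out X.1 z.1 z.2 X =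
        locE (TTouch (d := 4) (N := R.cubesPerDir X.1)) (fun Z : (tsys 4 (R.cubesPerDir X.1)).Dom => Z.1) (act X.1 z) X.2.1)
    {j : ℕ} {p : Op × Hist} (Φ : Type) (dat : Φ → Op × Hist) (X : TDom 4 (R.cubesPerDir j)) (φ : Φ) :
    (stepObjectOfActivitiesAt R M j p Φ dat (act j)).E X φ = M.Out j (dat φ).1 (dat φ).2 ⟨j, X⟩ := by
  rw [hrep ⟨j, X⟩ (dat φ)]
  unfold StepObjectD4.E
  congr 1

end Record

/-! ## §3 The torus-family corollary: H-layer data + seams ⟹ row D4's holomorphic-currency socket -/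

section Family

variable {d M : ℕ} [NeZero M]
variable {Op Hist : Type*} [NormedAddCommGroup Op] [NormedSpace ℂ Op] [NormedAddCommGroup Hist] [NormedSpace ℂ Hist]

/-- **ROW D4's SOCKET FROM A TORUS FAMILY OF H-LAYER DATA.**  For an exhausting torus sequence `N n → ∞`: per torus an NE5-type H-layer
datum — activities `act n : Op × Hist → 𝐃 → ℂ`, a data region `V n` on which every activity is ℂ-differentiable (`hhol`) and obeys
the Lemma-3 majorant (`hmaj`) — configuration types `Φ n` with data maps `dat n`, and seams `s n X : Wn n → Φ n` whose data images are
ℂ-differentiable on the α₂-ball (`hs`) and stay in `V n` (`hmaps`); plus `CondsL`, `0 ≤ C₃ε₁` and EXACTLY the row-D4 adapter's own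
remaining data ((190)-side `Data190`, (1.7)-factorization `hfac` through torus-independent spaces, test-vector convergence `hconv`,
read-out `a`).  Then `PolLeavesTFac190H d M a c ℓ α₂ q` — by the owner's `toPolLeavesTFac190H_ofActivities` applied to the objects
`stepObjectOfActivities (Φ n) (dat n) (act n) (V n)`.  Consumers: `Gaps.D4ScaleSlice.abs_beta1_le_of_leaves_at` (one (k, p)),
`Beta.RemainderStepAdapterHolo.remainderConst_of_leafLists` (all scales).
[cite: Balaban1987RG1, (1.7) p.261, (4.4) p.281, (4.35) p.290; Balaban1988RG2Cluster, p.15 and (2.38) p.20] -/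
def polLeavesTFac190HOfActivities (N : ℕ → ℕ) [hN : ∀ n, NeZero (N n)] (hNlim : Tendsto N atTop atTop)
    (Φ : ℕ → Type) (dat : (n : ℕ) → Φ n → Op × Hist) (act : (n : ℕ) → Op × Hist → TDom d (N n) → ℂ)
    (V : ℕ → Set (Op × Hist)) (c : B13.Consts) (ℓ α₂ : ℝ) (q : Consts190)
    (hmaj : ∀ n, ∀ z ∈ V n, ∀ Z : TDom d (N n),
      ‖act n z Z‖ ≤ c.C3act * c.ε₁ * Real.exp (-((1 - 8 * c.δ) * ℓ * c.κ * torusTreeLen Z.1)))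
    (hC : CondsL d c ℓ) (hA : 0 ≤ c.C3act * c.ε₁)
    (hhol : ∀ n, ∀ Z : TDom d (N n), DifferentiableOn ℂ (fun z : Op × Hist => act n z Z) (V n))
    (Wn : ℕ → Type) [instW : ∀ n, NormedAddCommGroup (Wn n)] [instWs : ∀ n, NormedSpace ℂ (Wn n)]
    (s : (n : ℕ) → TDom d (N n) → Wn n → Φ n)
    (hs : ∀ n X, DifferentiableOn ℂ (fun v => dat n (s n X v)) (ball 0 α₂))
    (hmaps : ∀ n X, MapsTo (fun v => dat n (s n X v)) (ball 0 α₂) (V n))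
    (D : Data190 d M N Wn q)
    (Vsp : LDom d → Type) [instV : ∀ Y, NormedAddCommGroup (Vsp Y)] [instVs : ∀ Y, NormedSpace ℂ (Vsp Y)]
    (F : (Y : LDom d) → Vsp Y → ℂ) (hFd : ∀ Y, ∃ ρ > 0, DifferentiableOn ℂ (F Y) (ball 0 ρ))
    (r : (n : ℕ) → (Y : LDom d) → Wn n →L[ℂ] Vsp Y)
    (hfac : ∀ Y : LDom d, ∀ᶠ n in atTop, ∀ v ∈ ball (0 : Wn n) α₂,
      (stepObjectOfActivities (Φ n) (dat n) (act n) (V n)).E (tproj (N n) Y) (s n (tproj (N n) Y) v) = F Y (r n Y v))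
    (t : (Y : LDom d) → Pt d → Vsp Y)
    (hconv : ∀ (Y : LDom d) (x : Pt d),
      Tendsto (fun n => r n Y (D.hn n (tproj (N n) Y) (proj (N n * M) x))) atTop (𝓝 (t Y x)))
    (a : LDom d → Pt d → ℝ) (ha : ∀ (Y : LDom d) (z : Pt d), a Y z = (mixedDeriv (F Y) (t Y 0) (t Y z)).re) :
    PolLeavesTFac190H d M a c ℓ α₂ q :=
  toPolLeavesTFac190H_ofActivities N hNlim (fun n => stepObjectOfActivities (Φ n) (dat n) (act n) (V n)) c ℓ α₂ q
    (fun n => lemma3OnH_of_activities (hmaj n)) hC hA Wn s (fun n X => mem_sp2_of_mapsTo (hmaps n X) X)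
    (fun n X Z _ => differentiableOn_H_of_activities (hhol n) (hs n X) (hmaps n X) Z) D Vsp F hFd r hfac t hconv a ha

end Family

end Summit.QuantumFields.BalabanUV.T4Continuum.Spine.NE5
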